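import Literature.Probability.Percolation.CouplingGSide
import Literature.Probability.Percolation.CoveringTameFibres
import Literature.Probability.Percolation.BoundedDegreeCriticalProb
import Mathlib.Analysis.SpecialFunctions.Pow.Real
import HarnessLib

/-!
# Strict monotonicity of `p_c` under quotients by free actions (Martineau–Severo 2019, Corollary 2.2):
# the discharge

Final file of the inline proof of `Literature.Probability.Percolation.MartineauSevero2019_cor22`
("`p_c(𝒢) < p_c(𝒢/Γ)` for a non-trivial group `Γ` acting freely by automorphisms with both graphs
quasi-transitive and `p_c(𝒢) < 1`"), following Martineau–Severo, Ann. Probab. 47 (2019), §4: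

* Proposition 4.2 (`EnhancementProp42.exists_lt_criticalProb_enhEvent_ge`): for every `s > 0` there is
  `p < p_c(ℋ)` with `inf_L ℙ_{p,s}(𝓔_L(ℋ)) > 0` (essential enhancement, Aizenman–Grimmett);
* Proposition 4.1 (`Coupling.enhMeasure_enhEvent_le_farEvent`): `ℙ_{p,s}(𝓔_L(ℋ)) ≤ P^𝒢_p(Far_L)` for the
  block parameters `p = 1-(1-p̂)^N`, `s = p̂^N` (the coupling of §5), made uniform in `p ≥ ε` here by the
  monotonicity of `ℙ_{p,s}(𝓔_L)` in `s` (`AGLine.theta_mono_s`) and the `N`-th root parametrisation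
  `p̂ = 1-(1-p)^{1/N}` (`exists_orParam_section`);
* the assembly `OrbitQuotient.criticalProb_lt_of_props` (`ε = p_c(ℋ)/2`, `p_c(ℋ) > 0` by bounded degree,
  `CoveringStrictMonotonicity`'s `criticalProb_pos_of_degree_le`), with the tameness radius of
  `CoveringTameFibres.exists_tame_pos` (Lemma 7.2 for free actions) feeding the two-lift structure
  `Coupling.TwoLiftData` (Lemma 7.1).

## References

* S. Martineau, F. Severo, *Strict monotonicity of percolation thresholds under covering maps*,
  Ann. Probab. 47 (2019) 4116–4136, Corollary 2.2, §4 (Propositions 4.1, 4.2), §5, §7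
  [MartineauSevero2019].
-/

noncomputable section

namespace Literature.Probability.Percolation

open MeasureTheory Literature.Barriers.CriticalPhenomena StarCoins
open scoped Classical

/-- **The `N`-th root parametrisation** `p̂(t) = 1 - (1-t)^{1/N}`: a monotone section of
`p̂ ↦ 1-(1-p̂)^N = orParam p̂ N`, positive at positive `t`. [folklore] -/
theorem exists_orParam_section {N : ℕ} (hN : N ≠ 0) :
    ∃ root : unitInterval → unitInterval, (∀ t, orParam (root t) N = t) ∧ Monotone root ∧
      ∀ t : unitInterval, 0 < (t : ℝ) → 0 < (root t : ℝ) := by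
  have hN' : (0 : ℝ) < (N : ℝ)⁻¹ := by positivity
  have h0 : ∀ t : unitInterval, 0 ≤ 1 - (t : ℝ) := fun t => sub_nonneg.2 t.2.2
  have h1 : ∀ t : unitInterval, 1 - (t : ℝ) ≤ 1 := fun t => sub_le_self _ t.2.1
  have hr0 : ∀ t : unitInterval, 0 ≤ (1 - (t : ℝ)) ^ ((N : ℝ)⁻¹) := fun t => Real.rpow_nonneg (h0 t) _
  have hr1 : ∀ t : unitInterval, (1 - (t : ℝ)) ^ ((N : ℝ)⁻¹) ≤ 1 := fun t =>
    Real.rpow_le_one (h0 t) (h1 t) hN'.le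
  refine ⟨fun t => ⟨1 - (1 - (t : ℝ)) ^ ((N : ℝ)⁻¹), sub_nonneg.2 (hr1 t), sub_le_self _ (hr0 t)⟩,
    fun t => ?_, fun t t' htt' => ?_, fun t ht => ?_⟩
  · apply Subtype.ext
    rw [coe_orParam]
    simp only [sub_sub_cancel]
    rw [Real.rpow_inv_natCast_pow (h0 t) hN]
    ring
  · change (1 : ℝ) - (1 - (t : ℝ)) ^ ((N : ℝ)⁻¹) ≤ 1 - (1 - (t' : ℝ)) ^ ((N : ℝ)⁻¹)
    have htt : (t : ℝ) ≤ t' := htt'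
    have := Real.rpow_le_rpow (h0 t') (by linarith : 1 - (t' : ℝ) ≤ 1 - t) hN'.le
    linarith
  · change (0 : ℝ) < 1 - (1 - (t : ℝ)) ^ ((N : ℝ)⁻¹)
    have := Real.rpow_lt_one (h0 t) (by linarith : 1 - (t : ℝ) < 1) hN'
    linarith

/-- **Martineau–Severo 2019, Corollary 2.2** (`p_c(𝒢) < p_c(𝒢/Γ)`), discharged.
[cite: MartineauSevero2019, Corollary 2.2; proof: §4 (Propositions 4.1, 4.2), §5, §6, §7] -/
theorem MartineauSevero2019_cor22_holds : MartineauSevero2019_cor22 := by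
  intro V _ G _ Γ _ _ hnt hact hfree hG hqG hqH x hpc
  haveI : Nontrivial Γ := hnt
  have hact' : IsActionByAut G Γ := hact
  letI : (orbitQuotientGraph G Γ).LocallyFinite := quotLocallyFinite hact'
  haveI : Countable (MulAction.orbitRel.Quotient Γ V) :=
    inferInstanceAs (Countable (Quotient (MulAction.orbitRel Γ V)))
  have hH : (orbitQuotientGraph G Γ).Connected := quot_connected hG
  -- bounded degree, `p_c(ℋ) > 0`
  obtain ⟨D₀, hD₀⟩ := hqG.exists_degree_le
  have hD : ∀ u, (orbitQuotientGraph G Γ).degree u ≤ D₀ := quot_degree_le_of_degree_le hact' hD₀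
  have hpcH : 0 < criticalProb (orbitQuotientGraph G Γ) (qmk Γ x) :=
    criticalProb_pos_of_degree_le _ hD _
  -- tame fibres (Lemma 7.2) and the two-lift structure (Lemma 7.1)
  obtain ⟨R, -, hR⟩ := exists_tame_pos hact' hfree hG hqG hqH
  have hR' : ∀ y, ∃ g : Γ, g • y ≠ y ∧ g • y ∈ graphBall G y R := fun y => by
    obtain ⟨g, hg, hgy⟩ := hR y
    exact ⟨g, fun h => hg (hfree g y h), hgy⟩
  obtain ⟨S⟩ := Coupling.nonempty_twoLiftData (r := R) hG hact' hfree (Nat.le_mul_of_pos_left R two_pos) hR'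
  -- the number of copies
  obtain ⟨N₀, hN₀u, hN₀d⟩ : ∃ N₀ : ℕ,
      (∀ u, 4 * R * (1 + ballVolume (orbitQuotientGraph G Γ) u (R + 1)) +
        2 * ballVolume (orbitQuotientGraph G Γ) u (R + 1) ≤ N₀) ∧
      ∀ e : Sym2 V, (Coupling.dom Γ G R e).card ≤ N₀ := by
    refine ⟨4 * R * (1 + (D₀ + 1) ^ (R + 1)) + 2 * (D₀ + 1) ^ (R + 1) + 2 * (D₀ + 1) ^ (3 * R + 2),
      fun u => ?_, fun e => ?_⟩
    · have hb : ballVolume (orbitQuotientGraph G Γ) u (R + 1) ≤ (D₀ + 1) ^ (R + 1) :=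
        ballVolume_le_pow_of_degree_le _ hD u (R + 1)
      have h1 : 4 * R * (1 + ballVolume (orbitQuotientGraph G Γ) u (R + 1)) ≤ 4 * R * (1 + (D₀ + 1) ^ (R + 1)) :=
        Nat.mul_le_mul_left _ (Nat.add_le_add_left hb _)
      have h2 : 2 * ballVolume (orbitQuotientGraph G Γ) u (R + 1) ≤ 2 * (D₀ + 1) ^ (R + 1) :=
        Nat.mul_le_mul_left _ hb
      omega
    · have h1 := Finset.card_union_le
        (ballFin (orbitQuotientGraph G Γ) (qmk Γ (EnhProp42.ends e).1) (3 * R + 2))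
        (ballFin (orbitQuotientGraph G Γ) (qmk Γ (EnhProp42.ends e).2) (3 * R + 2))
      have h2 := EnhProp42.card_ballFin_le_pow hD (qmk Γ (EnhProp42.ends e).1) (3 * R + 2)
      have h3 := EnhProp42.card_ballFin_le_pow hD (qmk Γ (EnhProp42.ends e).2) (3 * R + 2)
      unfold Coupling.dom
      omega
  -- work with `N = N₀ + 1 ≥ 1` copies
  have hNu : ∀ u, 4 * R * (1 + ballVolume (orbitQuotientGraph G Γ) u (R + 1)) +
      2 * ballVolume (orbitQuotientGraph G Γ) u (R + 1) ≤ N₀ + 1 := fun u => (hN₀u u).trans (Nat.le_succ _)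
  have hNd : ∀ e : Sym2 V, (Coupling.dom Γ G R e).card ≤ N₀ + 1 := fun e => (hN₀d e).trans (Nat.le_succ _)
  obtain ⟨root, hroot, hmono, hpos⟩ := exists_orParam_section (N := N₀ + 1) (Nat.succ_ne_zero _)
  -- the assembly
  refine OrbitQuotient.criticalProb_lt_of_props G (orbitQuotientGraph G Γ) (qmk Γ) x (qmk Γ x)
    (fun p s L => (EnhProp42.enhMeasure (orbitQuotientGraph G Γ) p s).real
      (enhEvent (orbitQuotientGraph G Γ) R (qmk Γ x) L)) (R + 1) hpc hpcH ?_ ?_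
  · -- Proposition 4.1, uniformly in `p ≥ ε`, with `s = p̂(ε)^N`
    intro ε hε0
    let e : unitInterval := ⟨min ε 1, le_min hε0.le zero_le_one, min_le_right _ _⟩
    have he0 : 0 < (e : ℝ) := lt_min hε0 one_pos
    refine ⟨andParam (root e) (N₀ + 1), ?_, fun p hεp L _ => ?_⟩
    · rw [coe_andParam]
      exact pow_pos (hpos e he0) _
    · have hep : e ≤ p := show min ε 1 ≤ (p : ℝ) from (min_le_left ε 1).trans hεp
      have h1 : (EnhProp42.enhMeasure (orbitQuotientGraph G Γ) p (andParam (root e) (N₀ + 1))).real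
            (enhEvent (orbitQuotientGraph G Γ) R (qmk Γ x) L) ≤
          (EnhProp42.enhMeasure (orbitQuotientGraph G Γ) p (andParam (root p) (N₀ + 1))).real
            (enhEvent (orbitQuotientGraph G Γ) R (qmk Γ x) L) := by
        rw [← EnhProp42.theta_eq_enhMeasure_real hH R (qmk Γ x) L p _,
          ← EnhProp42.theta_eq_enhMeasure_real hH R (qmk Γ x) L p _]
        refine AGLine.theta_mono_s (isUpperSet_enhEvent _ R (qmk Γ x) L) p.2.1 p.2.2
          (andParam (root e) (N₀ + 1)).2.1 ?_ (andParam (root p) (N₀ + 1)).2.2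
        rw [coe_andParam, coe_andParam]
        exact pow_le_pow_left₀ (root e).2.1 (hmono hep) _
      have h2 := Coupling.enhMeasure_enhEvent_le_farEvent hG hact' S x L (N₀ + 1) hNu hNd (root p)
      rw [hroot p] at h2
      exact h1.trans h2
  · -- Proposition 4.2
    intro hpc1 ε hε0 hε s hs
    exact EnhProp42.exists_lt_criticalProb_enhEvent_ge hH hD (qmk Γ x) R hpc1 hε0 hε s hs

end Literature.Probability.Percolation
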